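import Literature.NumberTheory.Transcendental.PhilipponZeroEstimateChainExact
import Literature.NumberTheory.Transcendental.PhilipponZeroEstimateMain
import HarnessLib

/-!
# Philippon's zero estimate on `𝔾ₐ × 𝔾ₘ^m` with multiplicities: the EXACT constant
# `𝓗(G; D₀, D₁) = (m+1)! D₀ D₁^m`, with the obstruction multiplicity kept symbolic

Topic `Literature/NumberTheory/Transcendental`. Companion of `PhilipponZeroEstimateHolds.lean`,
which discharges `Philippon1986_GaGm` with the lossy constant `c = (m+1)!·2^{(m+1)²}` and reads
the obstruction degree through the lower bound `mult(H₀) ≥ D₀^{δ₀} D₁^{δ₁}`. The present file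
re-runs D. Roy's assembly (Nesterenko–Philippon (eds.), LNM 1752, Ch. 11, Thm. 4.1, pp. 218–220)
with two changes and nothing else:

* the Bézout step along the chain of generic cuts uses the EXACT leading-coefficient bound
  `GaGm.sum_le_of_chain` / `GaGm.exists_chain` of `PhilipponZeroEstimateChainExact.lean` (iterated
  partial sums) instead of the lossy pointwise bound `GaGm.exists_ideal_hilbI_le` (doubling trick),
  so the right-hand side is the sharp `𝓗(G; D₀, D₁) = mult_{D₀,D₁}(G) = (m+1)! D₀ D₁^m`
  (`GaGm.mult_univ`);
* the multiplicity `mult_{D₀,D₁}(H₀)` of the obstructing connected algebraic subgroup `H₀` is kept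
  SYMBOLIC on the left-hand side (it is `𝓗(H₀; D₀, D₁)` in the printed statement), instead of
  being replaced by its lower bound `D₀^{dim V} D₁^{dim T}` (`GaGm.pow_le_mult`).

PROVED here: **`GaGm.zero_estimate_exact_subgroup`** (the obstruction as an irreducible closed
SUBGROUP `H₀` with `s` read through `GaGm.toConnAlgSubgroup H₀` — the internal currency of the
tree's proof, which the subtorus-degree formula consumes) and its repackaging
**`GaGm.zero_estimate_exact`** — for `D₀, D₁ ≥ 1`, `T ≥ 0`, a subspace `W` of
`Lie G = ℂ × ℂ^m`, a finite `Σ ∋ e`, and a nonzero `P ∈ Box_{D₀,D₁}(1)` (i.e. `deg_X P ≤ D₀`,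
`deg_{Y_h} P ≤ D₁` for every `h` — the `(ℙ¹)^{m+1}` box with equal torus degrees) vanishing to
order `≥ (m+1)T + 1` along `exp_G(W)` at every point of `Σ(m+1)`, there is a connected algebraic
subgroup `H` of `G`, with `H(ℂ)` irreducible of dimension `dim V + dim T ≤ m`, contained in a
translate of `Z(P)`, such that
`binom(T + s, s) · card((Σ·H)/H) · mult_{D₀,D₁}(H) ≤ (m+1)! · D₀ · D₁^m`,
`s = dim W − dim(W ∩ Lie H)`. This is Philippon 1986, Thm. 2.1 / Roy's Thm. 4.1 for
`G = 𝔾ₐ × 𝔾ₘ^m ⊂ (ℙ¹)^{m+1}` with its printed right-hand side `𝓗(G; D)`; combined with a formula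
for `mult_{D₀,D₁}(V × T_Φ)` in terms of the lattice `Φ` and with the isogeny `y_j ↦ y_j^{K/D_j}`
it is the input of Nesterenko 2003, Prop. 5.1 (`Nesterenko2003_prop51`,
`PhilipponZeroEstimateMultidegree.lean`). No named facts; nothing in the tree is edited.

## References

* P. Philippon, *Lemmes de zéros dans les groupes algébriques commutatifs*, Bull. Soc. Math.
  France 114 (1986), 355–383, Thm. 2.1 and Prop. 3.3; Errata et addenda, ibid. 115 (1987), 397–398.
* Yu. V. Nesterenko, P. Philippon (eds.), *Introduction to Algebraic Independence Theory*,
  LNM 1752, Springer 2001, Ch. 11 (D. Roy), Thm. 4.1, Prop. 2.2.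
* Yu. V. Nesterenko, *Linear forms in logarithms of rational numbers*, in: Diophantine
  Approximation (Cetraro 2000), LNM 1819, Springer 2003, 53–106, §5.1, Prop. 5.1 and (5.7).
-/

noncomputable section

open MvPolynomial Module
open scoped Pointwise

namespace Literature.NumberTheory.Transcendental

namespace GaGm

/-- Coset counts do not depend on how the subgroup is named. [folklore] -/
private theorem ncard_image_mk_congr {G : Type*} [Group G] {A B : Subgroup G} (h : A = B) (S : Set G) :
    Set.ncard ((QuotientGroup.mk : G → G ⧸ A) '' S) = Set.ncard ((QuotientGroup.mk : G → G ⧸ B) '' S) := by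
  subst h
  rfl

/-- **Philippon's zero estimate on `G = 𝔾ₐ × 𝔾ₘ^m ⊂ (ℙ¹)^{m+1}` with multiplicities, exact constant
and symbolic obstruction multiplicity — subgroup form** (Philippon 1986, Thm. 2.1; Roy, LNM 1752
Ch. 11 Thm. 4.1, for this `G`; the obstruction is returned as an irreducible closed subgroup
`H₀ ≤ G(ℂ)` of dimension `≤ m`, its Lie algebra read through `GaGm.toConnAlgSubgroup H₀`). Let
`D₀, D₁ ≥ 1`, `T ≥ 0`, `W ≤ Lie G = ℂ × ℂ^m`, `Σ ⊂ G(ℂ)` finite with `e ∈ Σ`, and `P ≠ 0` in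
`Box_{D₀,D₁}(1)` (`deg_X P ≤ D₀`, `deg_{Y_h} P ≤ D₁` for all `h`) with `ord_g P ≥ (m+1)T + 1`
along `exp_G(W)` at every `g ∈ Σ(m+1)`. Then there is an irreducible closed subgroup `H₀` of
`G(ℂ)` with `dim H₀ ≤ m`, `P` vanishing on a translate `g·H₀`, and
`binom(T + s, s) · card((Σ·H₀)/H₀) · mult_{D₀,D₁}(H₀) ≤ (m+1)! · D₀ · D₁^m`,
`s = dim W − dim(W ∩ Lie H₀)` — the printed
`binom(T + codim_A(A ∩ H), codim) · card((Σ+H)/H) · 𝓗(H; D) ≤ 𝓗(G; D)` with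
`𝓗(G; D₀, D₁) = (m+1)! D₀ D₁^m` (`GaGm.mult_univ`) and `𝓗(H; D) = GaGm.mult D₀ D₁ H`.
[cite: Philippon1986, Thm 2.1] [cite: NesterenkoPhilippon2001, Ch. 11 Thm. 4.1] -/
theorem zero_estimate_exact_subgroup {m D₀ D₁ T : ℕ} (W : Submodule ℂ (ℂ × (Fin m → ℂ))) {S : Set (GaGm m)}
    {P : MvPolynomial (Fin (m + 1)) ℂ} (hD₀ : 1 ≤ D₀) (hD₁ : 1 ≤ D₁) (hS : S.Finite)
    (h1 : (1 : GaGm m) ∈ S) (hP0 : P ≠ 0) (hPB : P ∈ Box (n := m) D₀ D₁ 1)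
    (hvan : ∀ g ∈ sumset S (m + 1), VanishesToOrder P W g ((m + 1) * T + 1)) :
    ∃ (H₀ : Subgroup (GaGm m)) (hirr : IsIrred (H₀ : Set (GaGm m))),
      dimG (H₀ : Set (GaGm m)) ≤ m ∧
      (∃ g : GaGm m, ∀ h ∈ H₀, evalAt P (g * h) = 0) ∧
      Nat.choose (T + (finrank ℂ W - finrank ℂ ↥(W ⊓ (toConnAlgSubgroup H₀ hirr).tangent)))
          (finrank ℂ W - finrank ℂ ↥(W ⊓ (toConnAlgSubgroup H₀ hirr).tangent)) *
        Set.ncard ((QuotientGroup.mk : GaGm m → GaGm m ⧸ H₀) '' S) *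
        mult D₀ D₁ (H₀ : Set (GaGm m)) ≤ (m + 1).factorial * D₀ * D₁ ^ m := by
  -- adapted from the tree's `Philippon1986_GaGm_holds` (PhilipponZeroEstimateHolds.lean): the
  -- descent, the primes of the cosets, the multiplicity estimate and thick additivity are taken
  -- over verbatim; the Bézout step is `exists_chain` + `sum_le_of_chain` (exact constant).
  classical
  -- the descent
  obtain ⟨H₀, hirr, Fgen, v₀, hFgenB, hv₀, hSE, hcosE, hdimcos, hdT, hdimEn⟩ :=
    exists_descent_data W h1 T hP0 hPB hvan
  set 𝔄 : Ideal (MvPolynomial (Fin (m + 1)) ℂ) := sat (Ideal.span Fgen) with h𝔄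
  set E : Set (GaGm m) := zeroSet (n := m) (𝔄 : Set (MvPolynomial (Fin (m + 1)) ℂ)) with hE
  have hdimH₀ : dimG (H₀ : Set (GaGm m)) ≤ m := by
    have h := hdimcos 1 h1
    rw [one_smul] at h
    rw [h]; exact hdimEn
  refine ⟨H₀, hirr, hdimH₀, ⟨v₀, hv₀⟩, ?_⟩
  set K := toConnAlgSubgroup H₀ hirr with hK
  set s := finrank ℂ W - finrank ℂ ↥(W ⊓ K.tangent) with hs
  set d' := dimG E with hd'
  have hEcl : IsClosedG E := isClosedG_zeroSet _
  have hEeq : E = zeroSet (n := m) Fgen := by rw [hE, h𝔄, zeroSet_sat, zeroSet_span]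
  have hvanE : vanishing E = 𝔄.radical := by rw [hEeq, ← zeroSet_span, h𝔄, radical_sat]
  have h𝔄E : (𝔄 : Set (MvPolynomial (Fin (m + 1)) ℂ)) ⊆ vanishing E := subset_vanishing_zeroSet _
  -- the cosets `Y = σ H₀`, `σ ∈ Σ`
  set 𝓨 : Finset (Set (GaGm m)) := hS.toFinset.image fun σ => σ • (H₀ : Set (GaGm m)) with h𝓨
  have hYrep : ∀ Y ∈ 𝓨, ∃ σ ∈ S, Y = σ • (H₀ : Set (GaGm m)) := fun Y hY => by
    obtain ⟨σ, hσ, rfl⟩ := Finset.mem_image.mp hY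
    exact ⟨σ, hS.mem_toFinset.mp hσ, rfl⟩
  choose! rep hrepS hrepY using hYrep
  have h1𝓨 : (1 : GaGm m) • (H₀ : Set (GaGm m)) ∈ 𝓨 := Finset.mem_image.mpr ⟨1, hS.mem_toFinset.mpr h1, rfl⟩
  haveI : Nonempty ↥𝓨 := ⟨⟨_, h1𝓨⟩⟩
  -- properties of a coset
  have hYirr : ∀ Y : ↥𝓨, IsIrred (Y : Set (GaGm m)) := fun Y => by
    rw [hrepY Y Y.2]; exact hirr.smul _
  have hYE : ∀ Y : ↥𝓨, (Y : Set (GaGm m)) ⊆ E := fun Y => by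
    rw [hrepY Y Y.2]; exact hcosE _ (hrepS Y Y.2)
  have hYdim : ∀ Y : ↥𝓨, dimG (Y : Set (GaGm m)) = d' := fun Y => by
    rw [hrepY Y Y.2]; exact hdimcos _ (hrepS Y Y.2)
  have hYdT : ∀ Y : ↥𝓨, (Y : Set (GaGm m)) ⊆
      zeroSet (n := m) (dIdeal W {(1 : GaGm m)} T 𝔄 : Set (MvPolynomial (Fin (m + 1)) ℂ)) := fun Y => by
    rw [hrepY Y Y.2]; exact hdT _ (hrepS Y Y.2)
  -- the primes
  set 𝔭 : ↥𝓨 → Ideal (MvPolynomial (Fin (m + 1)) ℂ) := fun Y => vanishing (Y : Set (GaGm m)) with h𝔭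
  have h𝔭p : ∀ Y, (𝔭 Y).IsPrime := fun Y => (hYirr Y).2
  have h𝔄le : ∀ Y, 𝔄 ≤ 𝔭 Y := fun Y => fun f hf => vanishing_antitone (hYE Y) (h𝔄E hf)
  have hu : ∀ Y, torusUnit m ∉ 𝔭 Y := fun Y hmem => by
    obtain ⟨y, hy⟩ := (hYirr Y).nonempty
    exact evalAt_torusUnit_ne_zero y (hmem y hy)
  have hmin : ∀ Y, 𝔭 Y ∈ 𝔄.minimalPrimes := fun Y => by
    obtain ⟨𝔮, h𝔮, hYeq⟩ := (hYirr Y).exists_eq_zeroSet_minimalPrimes hEcl (hYE Y) (hYdim Y)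
    have h := (isIrred_zeroSet_of_mem_minimalPrimes h𝔮).2.1
    rw [← hYeq] at h
    rw [← Ideal.radical_minimalPrimes, ← hvanE, show 𝔭 Y = 𝔮 from h]
    exact h𝔮
  have hrad : ∀ Y, ∃ M : ℕ, 𝔭 Y ^ M ≤ loc (𝔭 Y) (h𝔭p Y) 𝔄 := fun Y =>
    exists_pow_le_loc_of_mem_minimalPrimes (hmin Y)
  have hinc : ∀ Y Y' : ↥𝓨, 𝔭 Y ≤ 𝔭 Y' → Y = Y' := fun Y Y' hle => by
    have hsub : (Y' : Set (GaGm m)) ⊆ Y := by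
      rw [← (hYirr Y').isClosedG.eq, ← (hYirr Y).isClosedG.eq]
      exact zeroSet_antitone hle
    have heq := (hYirr Y).eq_of_subset_of_dimG_eq (hYirr Y').isClosedG (hYirr Y').nonempty hsub
      (by rw [hYdim, hYdim])
    exact Subtype.ext heq.symm
  -- the components and the multiplicity estimate at each coset
  have hcount : ∀ Y : ↥𝓨, ∃ cY : ℕ, ∀ t,
      (T + s).choose s * hilbI (n := m) D₀ D₁ ((𝔭 Y).restrictScalars ℂ) t ≤
        hilbI D₀ D₁ ((loc (𝔭 Y) (h𝔭p Y) 𝔄).restrictScalars ℂ) (t + cY * T) := fun Y => by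
    have hdTle : dIdeal W {(1 : GaGm m)} T 𝔄 ≤ 𝔭 Y := fun f hf =>
      vanishing_antitone (hYdT Y) (subset_vanishing_zeroSet _ hf)
    have h𝔄w := wordDeriv_mem_of_dIdeal_le (W := W) hdTle
    obtain ⟨cY, w, g, hwW, hg𝔭, hgB, hoff, hdiag⟩ := exists_transversal H₀ hirr (rep Y) hD₀ hD₁ W
    have hpY : vanishing ((rep Y) • (H₀ : Set (GaGm m))) = 𝔭 Y := by rw [h𝔭]; simp only; rw [← hrepY Y Y.2]
    rw [hpY] at hg𝔭 hoff hdiag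
    exact ⟨cY, fun t => choose_mul_hilbI_le (h𝔭p Y) hg𝔭 hoff hdiag (opPow_mem_of_mem_loc (h𝔭p Y) h𝔄w hwW) hgB t⟩
  choose cY hcY using hcount
  -- the sandwich of each coset
  have hmultY : ∀ Y : ↥𝓨, mult D₀ D₁ (Y : Set (GaGm m)) = mult D₀ D₁ (H₀ : Set (GaGm m)) := fun Y => by
    rw [hrepY Y Y.2]; exact mult_smul hD₀ hD₁ hirr _
  have hsand : ∀ Y : ↥𝓨, ∃ a : ℕ, ∀ t, a ≤ t →
      mult D₀ D₁ (H₀ : Set (GaGm m)) * (t - a + d').choose d' ≤ hilbI (n := m) D₀ D₁ ((𝔭 Y).restrictScalars ℂ) t := by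
    intro Y
    obtain ⟨a, γ, h⟩ := ((hYirr Y).hasMult hD₀ hD₁).1
    refine ⟨a, fun t ht => ?_⟩
    have := (h t ht).1
    rwa [hYdim, hmultY] at this
  choose aY haY using hsand
  -- thick additivity
  obtain ⟨δ, hδ⟩ := exists_sum_hilbI_loc_le hD₀ hD₁ 𝔄 𝔭 h𝔭p hinc h𝔄le hrad Finset.univ
  -- the chain of generic cuts (Roy's Prop. 2.2) and its EXACT Bézout bound
  obtain ⟨Fs, hFsF, hspanFs⟩ := exists_finset_span_eq_of_subset_Box hFgenB
  have hFgen𝔄 : Fgen ⊆ (𝔄 : Set (MvPolynomial (Fin (m + 1)) ℂ)) := fun f hf =>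
    le_sat _ (Ideal.subset_span hf)
  have hspanFs𝔄 : Ideal.span (↑Fs : Set (MvPolynomial (Fin (m + 1)) ℂ)) ≤ 𝔄 :=
    Ideal.span_le.mpr (hFsF.trans hFgen𝔄)
  set r' := m + 1 - d' with hr'
  have hd'le : d' ≤ m := hdimEn
  have hDH : ∀ 𝔭' : Ideal (MvPolynomial (Fin (m + 1)) ℂ), 𝔭'.IsPrime → (∃ Y, 𝔭' ≤ 𝔭 Y) →
      (↑Fs : Set (MvPolynomial (Fin (m + 1)) ℂ)) ⊆ 𝔭' → (r' : ℕ∞) ≤ 𝔭'.height := by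
    rintro 𝔭' h𝔭' ⟨Y, hle⟩ hFs
    have hu' : torusUnit m ∉ 𝔭' := fun h => hu Y (hle h)
    refine le_height_of_dimG_le h𝔭' hu' ((dimG_mono ?_).trans (le_of_eq rfl))
    -- `Z(𝔭') ⊆ Z(Fgen) = E`
    rw [hEeq]
    intro g hg f hf
    have hfspan : f ∈ Submodule.span ℂ (↑Fs : Set (MvPolynomial (Fin (m + 1)) ℂ)) := by
      rw [← hspanFs]; exact Submodule.subset_span hf
    have hf𝔭' : f ∈ 𝔭' := (Submodule.span_le.mpr hFs : Submodule.span ℂ (↑Fs : Set _) ≤ 𝔭'.restrictScalars ℂ) hfspan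
    exact hg f hf𝔭'
  obtain ⟨𝔍, Q, hJ0, hJne, hQB, hQnzd, hJstep, h𝔍le⟩ := exists_chain 𝔭 h𝔭p Fs r' hDH (D₀ := D₀) (D₁ := D₁)
    (hFsF.trans hFgenB) (fun Y => hFsF.trans (hFgen𝔄.trans (h𝔄le Y)))
  have h𝔍𝔮 : 𝔍 r' ≤ Finset.univ.inf fun Y => loc (𝔭 Y) (h𝔭p Y) 𝔄 :=
    Finset.le_inf fun Y _ => (h𝔍le Y).trans (loc_mono (h𝔭p Y) hspanFs𝔄)
  -- the binomial minorant of `H_{𝔍 r'}` in dimension `d'`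
  have hmain : ∀ t, δ + Finset.univ.sup (fun Y => cY Y * T + aY Y) ≤ t →
      ∑ Y ∈ (Finset.univ : Finset ↥𝓨), ((T + s).choose s * mult D₀ D₁ (H₀ : Set (GaGm m))) *
          (t - (δ + cY Y * T + aY Y) + d').choose d' ≤ hilbI (n := m) D₀ D₁ ((𝔍 r').restrictScalars ℂ) t := by
    intro t ht
    have hY : ∀ Y : ↥𝓨, cY Y * T + aY Y ≤ Finset.univ.sup (fun Y => cY Y * T + aY Y) := fun Y =>
      Finset.le_sup (f := fun Y => cY Y * T + aY Y) (Finset.mem_univ Y)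
    calc ∑ Y ∈ (Finset.univ : Finset ↥𝓨), ((T + s).choose s * mult D₀ D₁ (H₀ : Set (GaGm m))) *
          (t - (δ + cY Y * T + aY Y) + d').choose d'
        ≤ ∑ Y ∈ (Finset.univ : Finset ↥𝓨), hilbI (n := m) D₀ D₁ ((loc (𝔭 Y) (h𝔭p Y) 𝔄).restrictScalars ℂ) (t - δ) := by
          refine Finset.sum_le_sum fun Y _ => ?_
          have h1 := haY Y (t - δ - cY Y * T) (by have := hY Y; omega)
          have h2 := hcY Y (t - δ - cY Y * T)
          have e1 : t - δ - cY Y * T - aY Y = t - (δ + cY Y * T + aY Y) := by omega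
          have e2 : t - δ - cY Y * T + cY Y * T = t - δ := by have := hY Y; omega
          rw [e1] at h1
          rw [e2] at h2
          calc (T + s).choose s * mult D₀ D₁ (H₀ : Set (GaGm m)) * (t - (δ + cY Y * T + aY Y) + d').choose d'
              = (T + s).choose s * (mult D₀ D₁ (H₀ : Set (GaGm m)) * (t - (δ + cY Y * T + aY Y) + d').choose d') := by ring
            _ ≤ (T + s).choose s * hilbI (n := m) D₀ D₁ ((𝔭 Y).restrictScalars ℂ) (t - δ - cY Y * T) :=
                Nat.mul_le_mul_left _ h1
            _ ≤ _ := h2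
      _ ≤ hilbI D₀ D₁ ((Finset.univ.inf fun Y => loc (𝔭 Y) (h𝔭p Y) 𝔄).restrictScalars ℂ) t := hδ t (by omega)
      _ ≤ hilbI D₀ D₁ ((𝔍 r').restrictScalars ℂ) t := hilbI_antitone (fun x hx => h𝔍𝔮 hx) t
  -- the exact comparison of leading coefficients
  have hsum := sum_le_of_chain hD₀ hD₁ 𝔍 Q r' d' hJ0 hJne hQB hQnzd hJstep (by omega)
    (Finset.univ : Finset ↥𝓨) (fun _ => (T + s).choose s * mult D₀ D₁ (H₀ : Set (GaGm m)))
    (fun Y => δ + cY Y * T + aY Y) _ hmain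
  rw [Finset.sum_const, smul_eq_mul, Finset.card_univ, Fintype.card_coe] at hsum
  -- counting the cosets
  have hfib : ∀ x ∈ S, ∀ y ∈ S, (QuotientGroup.mk x : GaGm m ⧸ H₀) = QuotientGroup.mk y ↔
      x • (H₀ : Set (GaGm m)) = y • (H₀ : Set (GaGm m)) := by
    intro x _ y _
    rw [QuotientGroup.eq, leftCoset_eq_iff]
  have hncard : Set.ncard ((QuotientGroup.mk : GaGm m → GaGm m ⧸ H₀) '' S) = 𝓨.card := by
    rw [Descent.ncard_image_eq_of_fibres hS _ (fun σ => σ • (H₀ : Set (GaGm m))) hfib,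
      show (fun σ => σ • (H₀ : Set (GaGm m))) '' S = ↑𝓨 by rw [h𝓨, Finset.coe_image, hS.coe_toFinset],
      Set.ncard_coe_finset]
  -- assemble
  rw [hncard]
  calc (T + s).choose s * 𝓨.card * mult D₀ D₁ (H₀ : Set (GaGm m))
      = 𝓨.card * ((T + s).choose s * mult D₀ D₁ (H₀ : Set (GaGm m))) := by ring
    _ ≤ (m + 1).factorial * D₀ * D₁ ^ m := hsum

/-- **Philippon's zero estimate on `G = 𝔾ₐ × 𝔾ₘ^m ⊂ (ℙ¹)^{m+1}` with multiplicities, exact constant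
and symbolic obstruction multiplicity** (Philippon 1986, Thm. 2.1; Roy, LNM 1752 Ch. 11 Thm. 4.1,
for this `G`). Let `D₀, D₁ ≥ 1`, `T ≥ 0`, `W ≤ Lie G = ℂ × ℂ^m`, `Σ ⊂ G(ℂ)` finite with `e ∈ Σ`, and
`P ≠ 0` in `Box_{D₀,D₁}(1)` (`deg_X P ≤ D₀`, `deg_{Y_h} P ≤ D₁` for all `h`) with
`ord_g P ≥ (m+1)T + 1` along `exp_G(W)` at every `g ∈ Σ(m+1)`. Then there is a connected algebraic
subgroup `H` of `G` such that: `H(ℂ)` is irreducible, `dim H(ℂ) = dim V + dim T ≤ m`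
(`V`, `T` its additive and toric parts), `P` vanishes on a translate `g·H(ℂ)`, and
`binom(T + s, s) · card((Σ·H)/H) · mult_{D₀,D₁}(H(ℂ)) ≤ (m+1)! · D₀ · D₁^m`
with `s = dim W − dim(W ∩ Lie H)` — the printed
`binom(T + codim_A(A ∩ H), codim) · card((Σ+H)/H) · 𝓗(H; D) ≤ 𝓗(G; D)` with
`𝓗(G; D₀, D₁) = (m+1)! D₀ D₁^m` (`GaGm.mult_univ`) and `𝓗(H; D) = GaGm.mult D₀ D₁ H(ℂ)`.
[cite: Philippon1986, Thm 2.1] [cite: NesterenkoPhilippon2001, Ch. 11 Thm. 4.1] -/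
theorem zero_estimate_exact {m D₀ D₁ T : ℕ} (W : Submodule ℂ (ℂ × (Fin m → ℂ))) {S : Set (GaGm m)}
    {P : MvPolynomial (Fin (m + 1)) ℂ} (hD₀ : 1 ≤ D₀) (hD₁ : 1 ≤ D₁) (hS : S.Finite)
    (h1 : (1 : GaGm m) ∈ S) (hP0 : P ≠ 0) (hPB : P ∈ Box (n := m) D₀ D₁ 1)
    (hvan : ∀ g ∈ sumset S (m + 1), VanishesToOrder P W g ((m + 1) * T + 1)) :
    ∃ H : ConnAlgSubgroup m,
      IsIrred (H.toSubgroup : Set (GaGm m)) ∧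
      dimG (H.toSubgroup : Set (GaGm m)) = H.addDim + H.torusDim ∧
      H.addDim + H.torusDim ≤ m ∧
      (∃ g : GaGm m, ∀ h ∈ H.toSubgroup, evalAt P (g * h) = 0) ∧
      Nat.choose (T + (finrank ℂ W - finrank ℂ ↥(W ⊓ H.tangent)))
          (finrank ℂ W - finrank ℂ ↥(W ⊓ H.tangent)) *
        Set.ncard ((QuotientGroup.mk : GaGm m → GaGm m ⧸ H.toSubgroup) '' S) *
        mult D₀ D₁ (H.toSubgroup : Set (GaGm m)) ≤ (m + 1).factorial * D₀ * D₁ ^ m := by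
  obtain ⟨H₀, hirr, hdimH₀, ⟨v₀, hv₀⟩, hineq⟩ := zero_estimate_exact_subgroup W hD₀ hD₁ hS h1 hP0 hPB hvan
  set K := toConnAlgSubgroup H₀ hirr with hK
  have hKH : K.toSubgroup = H₀ := toSubgroup_toConnAlgSubgroup H₀ hirr
  have hKH' : (K.toSubgroup : Set (GaGm m)) = (H₀ : Set (GaGm m)) := by rw [hKH]
  have hdimK : dimG (H₀ : Set (GaGm m)) = K.addDim + K.torusDim := dimG_eq_addDim_add_torusDim H₀ hirr
  refine ⟨K, ?_, ?_, ?_, ⟨v₀, fun h hh => hv₀ h (by rw [hKH] at hh; exact hh)⟩, ?_⟩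
  · rw [hKH']; exact hirr
  · rw [hKH']; exact hdimK
  · rw [← hdimK]; exact hdimH₀
  · rw [ncard_image_mk_congr hKH S, hKH']
    exact hineq

end GaGm

end Literature.NumberTheory.Transcendental
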